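import Literature.MathematicalPhysics.QuantumFieldTheory.TwistedPartitionFunction
import Literature.MathematicalPhysics.QuantumFieldTheory.WilsonAxisSymmetry
import HarnessLib

/-!
# Crux `NonSimplyConnectedLatticeGap` (stmt-QuantumFields-16405), route `ConvexGribovBody`, line `Sketch` —
# stub `stub_twistPlaneExchange` ('t Hooft twist-plane exchange)

**Euclidean covariance of 't Hooft's twisted Wilson weights** on the symmetric discrete torus
`(ℤ/L)^d` ('t Hooft, Nucl. Phys. B 153 (1979) 141; Greensite, LNP 821 (2011) §4.4 (4.43)–(4.44)).
A permutation `π` of the coordinate axes that carries the coordinate plane `q' = (μ', ν')` onto the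
plane `q = (μ, ν)` *with orientation* (`π μ' = μ`, `π ν' = ν`) transports the `z`-twisted Boltzmann
weight of plane `q` to the `z`-twisted weight of plane `q'` at the same stack coordinates `(a, b)`,
for every integrand `F`:

  `∫ F(U) exp(-β S_{z;q;a,b}(U)) dU = ∫ F(P_π U) exp(-β S_{z;q';a,b}(U)) dU`,

where `P_π = configPerm π` is the relabelling of the links, `(P_π U)(x, i) = U(π⁻¹ x, π⁻¹ i)`, `dU` is
the product of the normalised Haar measures over the positively oriented links and
`S_{z;q;a,b} = insertedWilsonAction ρ (stackInsertion z q a b)` is the Wilson action with `z` inserted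
into the plaquettes of plane `q` based in the stack `{x_μ = a, x_ν = b}`.

Proof. (1) The deterministic identity `S_{z;q;a,b}(P_π U) = S_{z;q';a,b}(U)`
(`insertedWilsonAction_stackInsertion_configPerm`): the holonomy of `P_π U` around the
`(i, j)`-plaquette at `x` is the holonomy of `U` around the `(π⁻¹ i, π⁻¹ j)`-plaquette at `π⁻¹ x`
(`plaquetteHolonomy_configPerm`); plaquettes of plane `q` in the stack go exactly to plaquettes of
plane `q'` in the stack (`orderedInsertion_configPerm`), but possibly with reversed orientation for the
*other* planes, which is absorbed by summing the symmetric function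
`(y, k, l) ↦ N - Re tr ρ(t(y,k,l) U_{y,kl})` of *ordered* pairs of directions ('t Hooft's antisymmetric
extension `orderedInsertion` of the twist, `Re tr ρ(g⁻¹) = Re tr ρ(g)` on a compact group) and
re-indexing the off-diagonal sum along `(x, i, j) ↦ (π⁻¹ x, π⁻¹ i, π⁻¹ j)` (`sum_plaquette_perm`).
(2) `P_π` merely relabels the links, so it preserves the product Haar measure
(`measurePreserving_configPerm`); change variables `U = P_π V` and use (1).

Corollaries: the twisted partition functions of two such planes agree
(`insertedPartitionFunction_stackInsertion_perm`, `twistedPartitionFunction_perm`), and on the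
four-torus every pair of planes is so related (`exists_perm_plane_four`, `exists_perm_plane`).
-/

set_option autoImplicit false

noncomputable section

open MeasureTheory Literature.MathematicalPhysics.QuantumFieldTheory

namespace Summit.QuantumFields.YangMills.Theorems.NonSimplyConnectedLatticeGap

/-! ## Combinatorics: the twist and the plaquette sum under an axis permutation -/

section Combinatorics

variable {d L : ℕ} {G : Type*} [Group G]

/-- **The twist transported along an axis permutation.** If `π μ' = μ` and `π ν' = ν`, the ordered
(antisymmetric) insertion of plane `(μ', ν')`, stack `(a, b)`, read at the permuted plaquette
`(π⁻¹ x; π⁻¹ i, π⁻¹ j)` of a positively oriented plaquette `(x; i, j)`, `i < j`, is the stack insertion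
of plane `(μ, ν)`, stack `(a, b)`, at `(x; i, j)`: the reversed orientation `(π⁻¹ i, π⁻¹ j) = (ν', μ')`
would force `(i, j) = (ν, μ)`, impossible for `i < j`, `μ < ν`. [folklore] -/
theorem orderedInsertion_configPerm {μ ν μ' ν' : Fin d} (hμν : μ < ν) (π : Equiv.Perm (Fin d))
    (hμ : π μ' = μ) (hν : π ν' = ν) (z : G) (a b : ZMod L) (p : Plaquette d L) :
    orderedInsertion z μ' ν' a b (sitePerm π.symm p.1) (π.symm p.2.1.1) (π.symm p.2.1.2) =
      stackInsertion z ⟨(μ, ν), hμν⟩ a b p := by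
  obtain ⟨x, ⟨⟨i, j⟩, hij⟩⟩ := p
  subst hμ hν
  unfold orderedInsertion stackInsertion
  simp only [Subtype.mk.injEq, Prod.mk.injEq, sitePerm_apply, Equiv.symm_symm,
    Equiv.symm_apply_eq]
  have h2 : ¬ ((i = π ν' ∧ j = π μ') ∧ x (π μ') = a ∧ x (π ν') = b) := fun h => by
    obtain ⟨⟨rfl, rfl⟩, -⟩ := h
    exact lt_asymm hij hμν
  by_cases hA : (i = π μ' ∧ j = π ν') ∧ x (π μ') = a ∧ x (π ν') = b
  · rw [if_pos hA, if_pos hA]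
  · rw [if_neg hA, if_neg h2, if_neg hA]

variable [NeZero L]

/-- Re-indexing the off-diagonal double sum over ordered pairs of directions (and the sum over
sites) along `(x, i, j) ↦ (σ x, τ i, τ j)`. [folklore] -/
theorem sum_offDiag_perm (f : Site d L → Fin d → Fin d → ℝ) (σ : Equiv.Perm (Site d L))
    (τ : Equiv.Perm (Fin d)) :
    ∑ x : Site d L, ∑ i : Fin d, ∑ j : Fin d, (if i = j then 0 else f (σ x) (τ i) (τ j)) =
      ∑ x : Site d L, ∑ i : Fin d, ∑ j : Fin d, if i = j then 0 else f x i j := by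
  refine Fintype.sum_equiv σ _ _ fun x => ?_
  refine Fintype.sum_equiv τ _ _ fun i => Fintype.sum_equiv τ _ _ fun j => ?_
  simp only [EmbeddingLike.apply_eq_iff_eq]

/-- **Sums of symmetric plaquette functions are invariant under axis permutations**: for `f`
symmetric in the two directions, `∑ₚ f(σ p.1; τ p.i, τ p.j) = ∑ₚ f(p)` (both are half the
off-diagonal sum over ordered pairs, `two_mul_sum_plaquette`). [folklore] -/
theorem sum_plaquette_perm (f : Site d L → Fin d → Fin d → ℝ) (hf : ∀ x i j, f x i j = f x j i)
    (σ : Equiv.Perm (Site d L)) (τ : Equiv.Perm (Fin d)) :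
    ∑ p : Plaquette d L, f (σ p.1) (τ p.2.1.1) (τ p.2.1.2) =
      ∑ p : Plaquette d L, f p.1 p.2.1.1 p.2.1.2 := by
  apply mul_left_cancel₀ (two_ne_zero (α := ℝ))
  rw [two_mul_sum_plaquette (fun x i j => f (σ x) (τ i) (τ j)) (fun x i j => hf _ _ _),
    two_mul_sum_plaquette f hf]
  exact sum_offDiag_perm f σ τ

end Combinatorics

/-! ## The twisted action under an axis permutation -/

section Action

variable {d L N : ℕ} [NeZero L] {G : Type*} [Group G] [TopologicalSpace G] [IsTopologicalGroup G]
  [CompactSpace G] [MeasurableSpace G] (ρ : G →* Matrix (Fin N) (Fin N) ℂ)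

/-- **The twisted action under an axis permutation** ('t Hooft 1979; Greensite 2011 §4.4): if
`π μ' = μ` and `π ν' = ν` then `S_{z;(μ,ν);a,b}(P_π U) = S_{z;(μ',ν');a,b}(U)` for a continuous
representation `ρ` of the compact group `G` (the plaquettes of the other planes may be met in the
reversed orientation, harmless since `Re tr ρ(g⁻¹) = Re tr ρ(g)`).
[cite: Greensite2011Confinement, §4.4 (4.43)–(4.44)] -/
theorem insertedWilsonAction_stackInsertion_configPerm (hρ : Continuous ρ) (z : G)
    {μ ν μ' ν' : Fin d} (hμν : μ < ν) (hμν' : μ' < ν') (π : Equiv.Perm (Fin d)) (hμ : π μ' = μ)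
    (hν : π ν' = ν) (a b : ZMod L) (U : GaugeConfig d L G) :
    insertedWilsonAction ρ (stackInsertion z ⟨(μ, ν), hμν⟩ a b) (configPerm π U) =
      insertedWilsonAction ρ (stackInsertion z ⟨(μ', ν'), hμν'⟩ a b) U := by
  set g : Site d L → Fin d → Fin d → ℝ := fun y k l =>
    (N : ℝ) - (ρ (orderedInsertion z μ' ν' a b y k l * plaquetteHolonomy U y k l)).trace.re with hg
  have hsymm : ∀ y k l, g y k l = g y l k := by
    intro y k l
    simp only [hg]
    rw [orderedInsertion_swap (ne_of_lt hμν') z a b y k l, plaquetteHolonomy_swap U y k l,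
      re_trace_inv_mul_inv ρ hρ]
  calc insertedWilsonAction ρ (stackInsertion z ⟨(μ, ν), hμν⟩ a b) (configPerm π U)
      = ∑ p : Plaquette d L, g (sitePerm π.symm p.1) (π.symm p.2.1.1) (π.symm p.2.1.2) := by
        unfold insertedWilsonAction
        refine Finset.sum_congr rfl fun p _ => ?_
        simp only [hg]
        rw [plaquetteHolonomy_configPerm, orderedInsertion_configPerm hμν π hμ hν]
    _ = ∑ p : Plaquette d L, g p.1 p.2.1.1 p.2.1.2 :=
        sum_plaquette_perm g hsymm (sitePerm π.symm) π.symm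
    _ = insertedWilsonAction ρ (stackInsertion z ⟨(μ', ν'), hμν'⟩ a b) U := by
        unfold insertedWilsonAction
        refine Finset.sum_congr rfl fun p _ => ?_
        simp only [hg]
        rw [orderedInsertion_plaquette hμν']

end Action

/-! ## The change of variables -/

section Integral

variable {d L N : ℕ} [NeZero L] {G : Type*} [Group G] [TopologicalSpace G] [IsTopologicalGroup G]
  [CompactSpace G] [MeasurableSpace G] [BorelSpace G] (ρ : G →* Matrix (Fin N) (Fin N) ℂ)

/-- **An axis permutation preserves the product Haar measure** (it only relabels the links:
`configPerm π` is `MeasurableEquiv.arrowCongr'` of the link permutation `edgePerm π`). [folklore] -/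
theorem measurePreserving_configPerm (π : Equiv.Perm (Fin d)) :
    MeasurePreserving (configPerm π : GaugeConfig d L G ≃ᵐ GaugeConfig d L G)
      (Measure.pi fun _ : Edge d L => haarProbability G)
      (Measure.pi fun _ : Edge d L => haarProbability G) :=
  measurePreserving_arrowCongr' (fun _ : Edge d L => haarProbability G)
    (fun _ : Edge d L => haarProbability G) (edgePerm π) (MeasurableEquiv.refl G)
    fun _ => MeasurePreserving.id _

/-- **'t Hooft twist-plane exchange** (Euclidean covariance of the twisted Wilson weights): if the
axis permutation `π` carries plane `q'` onto plane `q` with orientation (`π q'.1.1 = q.1.1`,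
`π q'.1.2 = q.1.2`), then for every integrand `F`
`∫ F(U) exp(-β S_{z;q;a,b}(U)) dU = ∫ F(P_π U) exp(-β S_{z;q';a,b}(U)) dU` (product Haar measure,
continuous `ρ`; no measurability of `F` is needed since `P_π` is a measurable automorphism).
[cite: Greensite2011Confinement, §4.4 (4.43)–(4.44)] -/
theorem integral_mul_exp_stackInsertion_configPerm (hρ : Continuous ρ) (z : G) (β : ℝ)
    (q q' : {p : Fin d × Fin d // p.1 < p.2}) (a b : ZMod L) (π : Equiv.Perm (Fin d))
    (hμ : π q'.1.1 = q.1.1) (hν : π q'.1.2 = q.1.2) (F : GaugeConfig d L G → ℝ) :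
    ∫ U, F U * Real.exp (-(β * insertedWilsonAction ρ (stackInsertion z q a b) U))
        ∂(Measure.pi fun _ : Edge d L => haarProbability G) =
      ∫ U, F (configPerm π U) *
          Real.exp (-(β * insertedWilsonAction ρ (stackInsertion z q' a b) U))
        ∂(Measure.pi fun _ : Edge d L => haarProbability G) := by
  obtain ⟨⟨μ, ν⟩, hμν⟩ := q
  obtain ⟨⟨μ', ν'⟩, hμν'⟩ := q'
  dsimp only at hμ hν
  rw [← (measurePreserving_configPerm (G := G) π).integral_comp' (fun U : GaugeConfig d L G =>
      F U * Real.exp (-(β * insertedWilsonAction ρ (stackInsertion z ⟨(μ, ν), hμν⟩ a b) U)))]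
  simp only [insertedWilsonAction_stackInsertion_configPerm ρ hρ z hμν hμν' π hμ hν]

/-- **The twisted partition functions of two planes related by an oriented axis permutation
agree**: `Z_t` for `t` the `z`-twist of plane `q`, stack `(a, b)`, equals `Z_t` for the `z`-twist of
plane `q'`, stack `(a, b)` (the case `F ≡ 1` of `integral_mul_exp_stackInsertion_configPerm`).
[cite: Greensite2011Confinement, §4.4 (4.43)–(4.44)] -/
theorem insertedPartitionFunction_stackInsertion_perm (hρ : Continuous ρ) (β : ℝ) (z : G)
    (q q' : {p : Fin d × Fin d // p.1 < p.2}) (a b : ZMod L) (π : Equiv.Perm (Fin d))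
    (hμ : π q'.1.1 = q.1.1) (hν : π q'.1.2 = q.1.2) :
    insertedPartitionFunction ρ β L (stackInsertion z q a b) =
      insertedPartitionFunction ρ β L (stackInsertion z q' a b) := by
  have h := integral_mul_exp_stackInsertion_configPerm ρ hρ z β q q' a b π hμ hν (fun _ => 1)
  simpa only [one_mul, insertedPartitionFunction] using h

/-- **'t Hooft's twisted partition function depends on the twisted plane only through its orbit
under oriented axis permutations**: `Z_{β,L}(z; q) = Z_{β,L}(z; q')` whenever some permutation of
the axes maps `q'` onto `q` with orientation (any `z`, continuous `ρ`).
[cite: Greensite2011Confinement, §4.4 (4.43)–(4.44)] -/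
theorem twistedPartitionFunction_perm (hρ : Continuous ρ) (β : ℝ) (z : G)
    (q q' : {p : Fin d × Fin d // p.1 < p.2}) (π : Equiv.Perm (Fin d))
    (hμ : π q'.1.1 = q.1.1) (hν : π q'.1.2 = q.1.2) :
    twistedPartitionFunction ρ β L z q = twistedPartitionFunction ρ β L z q' := by
  rw [twistedPartitionFunction_eq_at, twistedPartitionFunction_eq_at,
    twistedPartitionFunctionAt_eq_inserted, twistedPartitionFunctionAt_eq_inserted]
  exact insertedPartitionFunction_stackInsertion_perm ρ hρ β z q q' 0 0 π hμ hν

end Integral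

/-! ## Existence of oriented axis permutations between coordinate planes -/

/-- **Any two coordinate planes are related by an oriented axis permutation**: for `μ < ν` and
`μ' < ν'` in `Fin d` there is `π` with `π μ' = μ`, `π ν' = ν` (first `ν' ↦ ν` by a transposition,
then move the image of `μ'` to `μ` by a transposition fixing `ν`). [folklore] -/
theorem exists_perm_plane {d : ℕ} (q q' : {p : Fin d × Fin d // p.1 < p.2}) :
    ∃ π : Equiv.Perm (Fin d), π q'.1.1 = q.1.1 ∧ π q'.1.2 = q.1.2 := by
  obtain ⟨⟨μ, ν⟩, hμν⟩ := q
  obtain ⟨⟨μ', ν'⟩, hμν'⟩ := q'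
  refine ⟨Equiv.swap (Equiv.swap ν' ν μ') μ * Equiv.swap ν' ν, ?_, ?_⟩
  · simp only [Equiv.Perm.mul_apply, Equiv.swap_apply_left]
  · simp only [Equiv.Perm.mul_apply, Equiv.swap_apply_left]
    refine Equiv.swap_apply_of_ne_of_ne ?_ (ne_of_gt hμν)
    intro h
    have h' := congrArg (Equiv.swap ν' ν) h
    rw [Equiv.swap_apply_right, Equiv.swap_apply_self] at h'
    exact (ne_of_lt hμν') h'.symm

/-- The four-dimensional case, by exhaustion. [folklore] -/
theorem exists_perm_plane_four (q q' : {p : Fin 4 × Fin 4 // p.1 < p.2}) :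
    ∃ π : Equiv.Perm (Fin 4), π q'.1.1 = q.1.1 ∧ π q'.1.2 = q.1.2 :=
  exists_perm_plane q q'

/-- Hence on any torus all six (for `d = 4`; all `d(d-1)/2` in general) twisted partition functions
`Z_{β,L}(z; q)` coincide (any `z`, continuous `ρ`). [cite: Greensite2011Confinement, §4.4 (4.43)–(4.44)] -/
theorem twistedPartitionFunction_plane_independent {d L N : ℕ} [NeZero L] {G : Type*} [Group G]
    [TopologicalSpace G] [IsTopologicalGroup G] [CompactSpace G] [MeasurableSpace G] [BorelSpace G]
    (ρ : G →* Matrix (Fin N) (Fin N) ℂ) (hρ : Continuous ρ) (β : ℝ) (z : G)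
    (q q' : {p : Fin d × Fin d // p.1 < p.2}) :
    twistedPartitionFunction ρ β L z q = twistedPartitionFunction ρ β L z q' := by
  obtain ⟨π, hμ, hν⟩ := exists_perm_plane q q'
  exact twistedPartitionFunction_perm ρ hρ β z q q' π hμ hν

/-! ## The registered stub -/

/-- **Stub `stub_twistPlaneExchange` of line `Sketch`** ('t Hooft twist-plane exchange, the first
lemma of the flux-sector mechanism): an axis permutation `π` carrying the coordinate plane `q'` onto
`q` with orientation transports the `z`-twisted weight of plane `q` to the `z`-twisted weight of
plane `q'` at the same stack coordinates, for every integrand `F`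
(`integral_mul_exp_stackInsertion_configPerm` with the registered binder structure).
[cite: Greensite2011Confinement, §4.4 (4.43)–(4.44)] -/
theorem stub_twistPlaneExchange : ∀ (d : ℕ) (G : Type) [Group G] [TopologicalSpace G] [IsTopologicalGroup G] [CompactSpace G] [MeasurableSpace G] [BorelSpace G] (N : ℕ) (ρ : G →* Matrix (Fin N) (Fin N) ℂ), Continuous ρ → ∀ (z : G) (β : ℝ) (L : ℕ) [NeZero L] (q q' : {p : Fin d × Fin d // p.1 < p.2}) (a b : ZMod L) (π : Equiv.Perm (Fin d)), π q'.1.1 = q.1.1 → π q'.1.2 = q.1.2 → ∀ F : Literature.MathematicalPhysics.QuantumFieldTheory.GaugeConfig d L G → ℝ, (∫ U, F U * Real.exp (-(β * Literature.MathematicalPhysics.QuantumFieldTheory.insertedWilsonAction ρ (Literature.MathematicalPhysics.QuantumFieldTheory.stackInsertion z q a b) U)) ∂(MeasureTheory.Measure.pi fun _ : Literature.MathematicalPhysics.QuantumFieldTheory.Edge d L => Literature.MathematicalPhysics.QuantumFieldTheory.haarProbability G)) = ∫ U, F (Literature.MathematicalPhysics.QuantumFieldTheory.configPerm π U) * Real.exp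 (-(β * Literature.MathematicalPhysics.QuantumFieldTheory.insertedWilsonAction ρ (Literature.MathematicalPhysics.QuantumFieldTheory.stackInsertion z q' a b) U)) ∂(MeasureTheory.Measure.pi fun _ : Literature.MathematicalPhysics.QuantumFieldTheory.Edge d L => Literature.MathematicalPhysics.QuantumFieldTheory.haarProbability G) := by
  intro d G _ _ _ _ _ _ N ρ hρ z β L _ q q' a b π hμ hν F
  exact integral_mul_exp_stackInsertion_configPerm ρ hρ z β q q' a b π hμ hν F

end Summit.QuantumFields.YangMills.Theorems.NonSimplyConnectedLatticeGap

end
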